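import Mathlib
import HarnessLib
import Literature.MathematicalPhysics.StatisticalMechanics.LinearisedMapSingleBlockWeight

/-!
# Lemma 10.3 / 10.4 of [ABKM19] with the regulator bound taken ALONG THE RAY `t ↦ tφ`
# (no locality of the weight `w_{k:k+1}^B` is needed)

`LinearisedMapSingleBlock.tayNorm_two_gauge_le_of_regulator` (and with it
`tayNorm_Pi2Rem_le_weighted`, `tayNormLE_Pi2Rem_of_w9`, `tayNormLE_blockTerm`, `weakNormLE_opC`)
asks the regulator `w` to be GAUGE-LOCAL for the gauge `T_k^{B*}` of the block neighbourhood
`B* = B + [−r_k, r_k]^d`.  The [ABKM19] weights are not: `w_k^X`, `w_{k:k+1}^X` depend on the field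
in `X^{++} = X + [−2L^k, 2L^k]^d ⊋ X*` ([ABKM19] Lemma 7.5 (iii); in the tree `nbRad R L k = 3L^k`
versus `starRad R L d k = 2^d L^{k−1}`), so that hypothesis is unsatisfiable for the concrete
weight tower.  The source does not need it: its two-norm estimate (8.3)/(13.24) is
`|g|_{T_φ} ≤ (1+|φ|)^{m+1} (|g|_{T_0} + ρ^{m+1} sup_{0≤t≤1} |g|_{k,T_{tφ}})`, a bound along the ray
`t ↦ tφ` in FIELD space, and the proof of Lemma 10.3 ((10.12)) only evaluates the weight at the
genuine fields `tφ` ("using the monotonicity of `t ↦ w_{k:k+1}(tφ)`").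

This file re-derives the chain in that form:

* `tphiSeminorm_le_of_tzero_of_ray` — the BBS two-norm estimate with the hypothesis only along
  the ray of the point (`∀ t ∈ [0,1], ‖F‖_{T_{tφ}(h)} ≤ F̄`), from
  `TphiSeminormTaylor.tphiSeminorm_taylorRemainder_le`;
* `tayNorm_two_gauge_le_of_ray` — gauge form: `‖T₁ξ‖ ≤ ρ‖T₂ξ‖`, `F` `T₁`-local,
  `∀ t ∈ [0,1], |F|^{(T₁)}_{T_{tφ}} ≤ F̄` ⟹ `|F|^{(T₂)}_{T_φ} ≤ (1+‖T₂φ‖)^{m+1}(|F|^{(T₂)}_{T_0} + 2ρ^{m+1}F̄)`;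
* **`tayNorm_Pi2Rem_le_weighted_of_ray`** — Lemma 10.3 exactly as `tayNorm_Pi2Rem_le_weighted`
  but WITHOUT `IsGaugeLocal T w`;
* **`tayNormLE_Pi2Rem_of_w9_of_ray`** — Lemma 10.4 (pointwise) as `tayNormLE_Pi2Rem_of_w9`, without
  `IsGaugeLocal T w`.

Everything here is proved; no named fact.

## References
* S. Adams, S. Buchholz, R. Kotecký, S. Müller, arXiv:1910.13564, Lemma 8.1 (8.3), Prop. 13.11
  (13.24), Lemma 10.3 ((10.10)–(10.12)), Lemma 10.4 (10.13) [AdamsBuchholzKoteckyMuller2019].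
* R. Bauerschmidt, D. Brydges, G. Slade, LNM 2242 (2019), Corollary 7.5.4 [BauerschmidtBrydgesSlade2019RG].
-/

noncomputable section

namespace Literature.MathematicalPhysics.StatisticalMechanics.GradientRG

open Finset
open Literature.MathematicalPhysics.QuantumFieldTheory

/-! ## The two-norm estimate along a ray -/

section Ray

variable {E V : Type*} [NormedAddCommGroup E] [NormedSpace ℝ E]
  [NormedAddCommGroup V] [NormedSpace ℝ V]
  {𝔸 : Type*} [NormedRing 𝔸] [NormedAlgebra ℝ 𝔸] [CompleteSpace 𝔸]

/-- **Two-norm estimate, ray form** ([BBS19] Cor. 7.5.4 / [ABKM19] Prop. 13.11 (13.24)): for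
`0 < ℓ ≤ h`, `k < N`, `F ∈ C^N` and a bound `‖F‖_{T_{tφ}(h)} ≤ F̄` for `t ∈ [0,1]` along the ray of
`φ` only, `‖F‖_{T_φ(ℓ)} ≤ (1 + ‖φ‖/ℓ)^{k+1} (‖F‖_{T_0(ℓ)} + 2(ℓ/h)^{k+1} F̄)`.
[cite: AdamsBuchholzKoteckyMuller2019, Proposition 13.11 (13.24)] -/
theorem tphiSeminorm_le_of_tzero_of_ray (N : ℕ) {k : ℕ} (hk : k < N) {ℓ h : ℝ} (hℓ : 0 < ℓ)
    (hle : ℓ ≤ h) {F : E → 𝔸} (hF : ContDiff ℝ N F) (φ : E) {Fbar : ℝ}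
    (hFbar : ∀ t ∈ Set.Icc (0 : ℝ) 1, tphiSeminorm N h F (t • φ) ≤ Fbar) :
    tphiSeminorm N ℓ F φ ≤
      (1 + ‖φ‖ / ℓ) ^ (k + 1) * (tphiSeminorm N ℓ F 0 + 2 * (ℓ / h) ^ (k + 1) * Fbar) := by
  have hP1 : 1 ≤ 1 + ‖φ‖ / ℓ := le_add_of_nonneg_right (div_nonneg (norm_nonneg _) hℓ.le)
  have hT : ContDiff ℝ N (taylorPolyFD k F) := taylorPolyFD_contDiff k F
  have hdecomp : F = fun x => taylorPolyFD k F x + (F x - taylorPolyFD k F x) := by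
    funext x; abel
  have h1 := tphiSeminorm_taylorPolyFD_le N hℓ F hk.le φ
  have h2 := tphiSeminorm_taylorRemainder_le N hk hℓ hle hF φ hFbar
  have h0 : 0 ≤ tphiSeminorm N ℓ F 0 := tphiSeminorm_nonneg N hℓ.le F 0
  have hFbar0 : 0 ≤ Fbar :=
    (tphiSeminorm_nonneg N (hℓ.le.trans hle) F _).trans (hFbar 0 ⟨le_rfl, zero_le_one⟩)
  have hρ0 : 0 ≤ ℓ / h := div_nonneg hℓ.le (hℓ.le.trans hle)
  have hPk : (1 + ‖φ‖ / ℓ) ^ k ≤ (1 + ‖φ‖ / ℓ) ^ (k + 1) := pow_le_pow_right₀ hP1 (Nat.le_succ k)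
  calc tphiSeminorm N ℓ F φ
      = tphiSeminorm N ℓ (fun x => taylorPolyFD k F x + (F x - taylorPolyFD k F x)) φ := by
        rw [← hdecomp]
    _ ≤ tphiSeminorm N ℓ (taylorPolyFD k F) φ +
          tphiSeminorm N ℓ (fun x => F x - taylorPolyFD k F x) φ :=
        tphiSeminorm_add_le N hℓ.le hT (hF.sub hT) φ
    _ ≤ tphiSeminorm N ℓ F 0 * (1 + ‖φ‖ / ℓ) ^ k +
          2 * (ℓ / h) ^ (k + 1) * (1 + ‖φ‖ / ℓ) ^ (k + 1) * Fbar := add_le_add h1 h2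
    _ ≤ tphiSeminorm N ℓ F 0 * (1 + ‖φ‖ / ℓ) ^ (k + 1) +
          2 * (ℓ / h) ^ (k + 1) * (1 + ‖φ‖ / ℓ) ^ (k + 1) * Fbar := by gcongr
    _ = (1 + ‖φ‖ / ℓ) ^ (k + 1) * (tphiSeminorm N ℓ F 0 + 2 * (ℓ / h) ^ (k + 1) * Fbar) := by ring

variable [FiniteDimensional ℝ E]

/-- **Two-norm estimate with two gauges, ray form** ([ABKM19] Prop. 13.11 / Lemma 8.1 (8.3) as used
in (10.11)–(10.12)): let `‖T₁ ξ‖ ≤ ρ ‖T₂ ξ‖` (`0 < ρ ≤ 1`), `F` `T₁`-local and `C^{r₀}`, `m < r₀`, and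
`|F|^{(T₁)}_{T_{tφ}} ≤ F̄` for all `t ∈ [0,1]` (a bound along the ray of `φ` in field space — e.g.
`F̄ = C_F w(φ)` for a weight monotone along rays, NOT necessarily gauge-local).  Then
`|F|^{(T₂)}_{T_φ} ≤ (1 + ‖T₂φ‖)^{m+1} (|F|^{(T₂)}_{T_0} + 2ρ^{m+1} F̄)`.
[cite: AdamsBuchholzKoteckyMuller2019, Proposition 13.11] -/
theorem tayNorm_two_gauge_le_of_ray {V₁ : Type*} [NormedAddCommGroup V₁] [NormedSpace ℝ V₁]
    (T₁ : E →ₗ[ℝ] V₁) (T₂ : E →ₗ[ℝ] V) {ρ : ℝ} (hρ0 : 0 < ρ) (hρ1 : ρ ≤ 1)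
    (h : ∀ ξ, ‖T₁ ξ‖ ≤ ρ * ‖T₂ ξ‖) {r₀ m : ℕ} (hm : m < r₀) {F : E → 𝔸} (hF : ContDiff ℝ r₀ F)
    (hloc : IsGaugeLocal T₁ F) (φ : E) {Fbar : ℝ}
    (hFA : ∀ t ∈ Set.Icc (0 : ℝ) 1, tayNorm T₁ r₀ F (t • φ) ≤ Fbar) :
    tayNorm T₂ r₀ F φ ≤
      (1 + ‖T₂ φ‖) ^ (m + 1) * (tayNorm T₂ r₀ F 0 + 2 * ρ ^ (m + 1) * Fbar) := by
  -- along the ray of `T₂ φ` in the gauge space `range T₂`, with field unit `1/ρ ≥ 1`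
  have hray : ∀ t ∈ Set.Icc (0 : ℝ) 1,
      tphiSeminorm r₀ ρ⁻¹ (gaugeLift T₂ F) (t • T₂.rangeRestrict φ) ≤ Fbar := by
    intro t ht
    rw [← map_smul]
    calc tphiSeminorm r₀ ρ⁻¹ (gaugeLift T₂ F) (T₂.rangeRestrict (t • φ))
        ≤ tphiSeminorm r₀ (ρ⁻¹ * ρ) (gaugeLift T₁ F) (T₁.rangeRestrict (t • φ)) :=
          tphiSeminorm_gaugeLift_mono_gauge T₁ T₂ hρ0.le h hF hloc (inv_nonneg.2 hρ0.le) _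
      _ = tayNorm T₁ r₀ F (t • φ) := by rw [inv_mul_cancel₀ hρ0.ne', ← tayNorm_eq_tphiSeminorm]
      _ ≤ Fbar := hFA t ht
  have key := tphiSeminorm_le_of_tzero_of_ray r₀ hm one_pos (one_le_inv_iff₀.2 ⟨hρ0, hρ1⟩)
    (contDiff_gaugeLift T₂ hF) (T₂.rangeRestrict φ) hray
  rw [tayNorm_eq_tphiSeminorm, tayNorm_eq_tphiSeminorm, map_zero]
  rw [div_one, one_div, inv_inv] at key
  exact key

end Ray

/-! ## Lemma 10.3 without locality of the weight -/

section SingleBlock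

variable {𝕜 : Type*} [NormedField 𝕜] [NormedAlgebra ℝ 𝕜] [CompleteSpace 𝕜] {d M : ℕ} [NeZero M]

variable {a : Fin d → ZMod M} {B S S' : Finset (Fin d → ZMod M)} {p r₀ ρ' : ℕ}
  {𝔥 𝔥' R R' L κ C₁ : ℝ} {K : ((Fin d → ZMod M) → ℝ) → 𝕜}

/-- **Lemma 10.3 (pointwise single-block contraction), weight evaluated along rays only.**
In the setting of Lemma 8.9 (box `S = a + [0,ρ']^d ⊇ B` with room for the test polynomials,
scales `R' = LR`, `𝔥' ≤ κ𝔥`, `𝔥' ≤ 𝔥`, `ρ = (𝔥'/𝔥)(R/R') ≤ 1`, `r₀ ≥ 3`), let `F` be `C^{r₀}` and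
`T`-local with `|F|_{T_ψ} ≤ C_F w(ψ)` for a weight `w ≥ 1` with `w(0) = 1`, monotone along rays
(`w(tψ) ≤ w(ψ)`, `t ∈ [0,1]`) — no locality of `w` is assumed.  Then for every `φ`
`|F − Π₂F(B)|_{T'_φ} ≤ C_F c_G (1 + ‖T'φ‖)⁵ w(φ)`, `c_G = blockContrConst`.
[cite: AdamsBuchholzKoteckyMuller2019, Lemma 10.3] -/
theorem tayNorm_Pi2Rem_le_weighted_of_ray (hS : ∀ x, x ∈ S ↔ InBox a ρ' x) (ha : InBox a ρ' a)
    (hroom : ∀ x ∈ S, HasRoom a x p) (hp : d / 2 + 2 ≤ p) (hBS : B ⊆ S) (hB : B.card ≠ 0)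
    {C₀ : ℝ} (h𝔥 : 0 < 𝔥) (h𝔥' : 0 < 𝔥') (hR : 0 < R) (hL : 1 ≤ L) (hRR : R' = L * R)
    (hκ : 𝔥' ≤ κ * 𝔥) (h𝔥'le : 𝔥' ≤ 𝔥) (hC₁ : 0 ≤ C₁) (hρ : (ρ' : ℝ) ≤ C₁ * R) (hC₀ : 1 ≤ C₀)
    (hρ0 : (ρ' : ℝ) + (d / 2 + 1 : ℕ) ≤ C₀ * R) (hθ : 𝔥' / 𝔥 * (R / R') ≤ 1) (hr₀ : 3 ≤ r₀)
    (hK : ContDiff ℝ r₀ K) (hloc : IsGaugeLocal (fieldGauge 𝔥 R p S) K)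
    {w : ((Fin d → ZMod M) → ℝ) → ℝ} (hw1 : ∀ ψ, 1 ≤ w ψ) (hw0 : w 0 = 1)
    (hwray : ∀ ψ : (Fin d → ZMod M) → ℝ, ∀ t ∈ Set.Icc (0 : ℝ) 1, w (t • ψ) ≤ w ψ)
    {CF : ℝ} (hCF : 0 ≤ CF) (hKw : ∀ ψ, tayNorm (fieldGauge 𝔥 R p S) r₀ K ψ ≤ CF * w ψ)
    (φ : (Fin d → ZMod M) → ℝ) :
    tayNorm (fieldGauge 𝔥' R' p S) r₀ (Pi2Rem a B K) φ ≤
      CF * blockContrConst d 𝔥 𝔥' R R' L κ C₁ C₀ * (1 + ‖fieldGauge 𝔥' R' p S φ‖) ^ 5 * w φ := by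
  set T := fieldGauge 𝔥 R p S with hT
  set T' := fieldGauge 𝔥' R' p S with hT'
  set C₂ := pi2BoundConst d C₀ with hC₂
  set ε := pi2ContrFactor d 𝔥 𝔥' R R' L κ C₁ with hε
  set ρ : ℝ := 𝔥' / 𝔥 * (R / R') with hρdef
  have hR' : 0 < R' := by rw [hRR]; nlinarith
  have hRR' : R ≤ R' := by rw [hRR]; nlinarith
  have hρpos : 0 < ρ := by positivity
  have hp' : d / 2 + 1 ≤ p := by omega
  have hr₀2 : 2 ≤ r₀ := by omega
  have hC₂0 : 0 ≤ C₂ := pi2BoundConst_nonneg d (by linarith)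
  have hκ0 : 0 ≤ κ := by nlinarith
  have hL0 : 0 < L := by linarith
  have hε0 : 0 ≤ ε := by simp only [hε, pi2ContrFactor]; positivity
  -- the relevant part `E = Π₂F(B)` and its bounds
  set Epart : ((Fin d → ZMod M) → ℝ) → 𝕜 := fun φ => eval (Pi2 a B K) B φ with hE
  have hEd : ContDiff ℝ r₀ Epart := contDiff_eval _ _
  have hSρ : ∀ x ∈ S, ∀ i, |relCoord a x i| ≤ ρ' := fun x hx i => by
    obtain ⟨h1, h2⟩ := (hS x).1 hx i
    rw [abs_of_nonneg h1]; exact h2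
  have hK0 : tayNorm T r₀ K 0 ≤ CF := by have := hKw 0; rwa [hw0, mul_one] at this
  have hham : hamNorm 𝔥 R B.card (Pi2 a B K) ≤ C₂ * CF :=
    (hamNorm_Pi2_le hB hBS hroom hSρ h𝔥 hR hC₀ hρ0 hr₀2 hK hloc).trans
      (mul_le_mul_of_nonneg_left hK0 hC₂0)
  -- Step A: the regulator bound at scale `k`: `|Pi2Rem F|_{T_ψ} ≤ C_F(1+C₂)(1+‖Tψ‖)² w(ψ)`
  have hA : ∀ ψ, tayNorm T r₀ (Pi2Rem a B K) ψ ≤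
      CF * (1 + C₂) * ((1 + ‖T ψ‖) ^ 2 * w ψ) := by
    intro ψ
    have hdec : Pi2Rem a B K = K + (-1 : ℝ) • Epart := by
      rw [Pi2Rem, neg_one_smul, sub_eq_add_neg]
    have h1 : tayNorm T r₀ (Pi2Rem a B K) ψ ≤ tayNorm T r₀ K ψ + tayNorm T r₀ Epart ψ := by
      have hG : ContDiff ℝ r₀ ((-1 : ℝ) • Epart) := hEd.const_smul (-1 : ℝ)
      have h1' := tayNorm_add_le T hK hG ψ
      rw [tayNorm_smul T hEd, abs_neg, abs_one, one_mul] at h1'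
      rw [hdec]; exact h1'
    have h2 : tayNorm T r₀ Epart ψ ≤ (1 + ‖T ψ‖) ^ 2 * (C₂ * CF) :=
      (tayNorm_eval_le h𝔥 hR hp' hBS (Pi2 a B K) r₀ ψ).trans
        (mul_le_mul_of_nonneg_left hham (by positivity))
    have h3 := hKw ψ
    have hw := hw1 ψ
    have ht : (1 : ℝ) ≤ (1 + ‖T ψ‖) ^ 2 := one_le_pow₀ (by linarith [norm_nonneg (T ψ)])
    have h4 : CF * w ψ ≤ CF * ((1 + ‖T ψ‖) ^ 2 * w ψ) :=
      mul_le_mul_of_nonneg_left (le_mul_of_one_le_left (by linarith) ht) hCF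
    have h5 : (1 + ‖T ψ‖) ^ 2 * (C₂ * CF) ≤ CF * C₂ * ((1 + ‖T ψ‖) ^ 2 * w ψ) := by
      have : (1 + ‖T ψ‖) ^ 2 * (C₂ * CF) * 1 ≤ (1 + ‖T ψ‖) ^ 2 * (C₂ * CF) * w ψ :=
        mul_le_mul_of_nonneg_left hw (by positivity)
      linarith
    calc tayNorm T r₀ (Pi2Rem a B K) ψ ≤ CF * w ψ + (1 + ‖T ψ‖) ^ 2 * (C₂ * CF) := by linarith
      _ ≤ CF * (1 + C₂) * ((1 + ‖T ψ‖) ^ 2 * w ψ) := by linarith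
  -- Step B: the two-norm estimate along the ray `t ↦ tφ` with `F̄ = C_F(1+C₂)(1+‖Tφ‖)² w(φ)`
  have hray : ∀ t ∈ Set.Icc (0 : ℝ) 1, tayNorm T r₀ (Pi2Rem a B K) (t • φ) ≤
      CF * (1 + C₂) * ((1 + ‖T φ‖) ^ 2 * w φ) := by
    intro t ht
    have ht1 : ‖T (t • φ)‖ ≤ ‖T φ‖ := by
      rw [map_smul, norm_smul, Real.norm_eq_abs, abs_of_nonneg ht.1]
      exact mul_le_of_le_one_left (norm_nonneg _) ht.2
    have hw0' : 0 ≤ w (t • φ) := by linarith [hw1 (t • φ)]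
    refine (hA _).trans (mul_le_mul_of_nonneg_left ?_ (by positivity))
    calc (1 + ‖T (t • φ)‖) ^ 2 * w (t • φ) ≤ (1 + ‖T φ‖) ^ 2 * w (t • φ) := by gcongr
      _ ≤ (1 + ‖T φ‖) ^ 2 * w φ := mul_le_mul_of_nonneg_left (hwray φ t ht) (by positivity)
  have hB2 := tayNorm_two_gauge_le_of_ray T T' hρpos hθ
    (fun ξ => norm_fieldGauge_le_mul h𝔥 h𝔥' hR hRR' p S ξ) (m := 2) (by omega)
    (contDiff_Pi2Rem hK) (isGaugeLocal_Pi2Rem h𝔥.ne' hR.ne' hp' hBS hloc) φ hray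
  -- Step C: Lemma 8.9 at `T'_0`
  have hC : tayNorm T' r₀ (Pi2Rem a B K) 0 ≤ ε * (1 + C₂) * CF :=
    (tayNorm_Pi2Rem_le hS ha hroom hp hBS hB h𝔥 h𝔥' hR hL hRR hκ hC₁ hρ hC₀ hρ0 hθ hr₀2 hK hloc).trans
      (mul_le_mul_of_nonneg_left hK0 (by positivity))
  -- Step D: assemble, using `‖Tφ‖ ≤ ‖T'φ‖` and `1 ≤ (1+‖T'φ‖)² w(φ)`
  have htt : ‖T φ‖ ≤ ‖T' φ‖ := norm_fieldGauge_mono_weights h𝔥' h𝔥'le hR hRR' p S φ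
  set t' := ‖T' φ‖ with ht'
  have ht'0 : 0 ≤ t' := norm_nonneg _
  have hwφ := hw1 φ
  have hsq : (1 + ‖T φ‖) ^ 2 ≤ (1 + t') ^ 2 := by
    have : 0 ≤ 1 + ‖T φ‖ := by linarith [norm_nonneg (T φ)]
    gcongr
  have h1t : (1 : ℝ) ≤ (1 + t') ^ 2 * w φ := by
    have : (1 : ℝ) ≤ (1 + t') ^ 2 := one_le_pow₀ (by linarith)
    nlinarith
  calc tayNorm T' r₀ (Pi2Rem a B K) φ
      ≤ (1 + t') ^ 3 * (tayNorm T' r₀ (Pi2Rem a B K) 0 +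
          2 * ρ ^ 3 * (CF * (1 + C₂) * ((1 + ‖T φ‖) ^ 2 * w φ))) := hB2
    _ ≤ (1 + t') ^ 3 * (ε * (1 + C₂) * CF * ((1 + t') ^ 2 * w φ) +
          2 * ρ ^ 3 * (CF * (1 + C₂) * ((1 + t') ^ 2 * w φ))) := by
        have hw0' : 0 ≤ w φ := by linarith
        gcongr
        calc tayNorm T' r₀ (Pi2Rem a B K) 0 ≤ ε * (1 + C₂) * CF := hC
          _ = ε * (1 + C₂) * CF * 1 := (mul_one _).symm
          _ ≤ ε * (1 + C₂) * CF * ((1 + t') ^ 2 * w φ) :=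
              mul_le_mul_of_nonneg_left h1t (by positivity)
    _ = CF * blockContrConst d 𝔥 𝔥' R R' L κ C₁ C₀ * (1 + t') ^ 5 * w φ := by
        rw [blockContrConst, ← hC₂, ← hε, ← hρdef]; ring

/-- **Lemma 10.4 (pointwise): `|G(B)|_{k+1,B',T_φ} ≤ 1536 c_G ‖K‖ w_{k+1}^{B'}(φ)`**, weight evaluated
along rays only.  As `tayNormLE_Pi2Rem_of_w9` (larger gauge set `S' ⊇ S`, (w9)-type hypothesis
`e^{‖T'_{S'}φ‖²/2} w(φ) ≤ w'(φ)`) but without locality of `w`: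
`‖F − Π₂F(B)‖_{T'_{S'}, w'} ≤ 1536 C_F c_G`. [cite: AdamsBuchholzKoteckyMuller2019, Lemma 10.4 (10.13)] -/
theorem tayNormLE_Pi2Rem_of_w9_of_ray (hS : ∀ x, x ∈ S ↔ InBox a ρ' x) (ha : InBox a ρ' a)
    (hroom : ∀ x ∈ S, HasRoom a x p) (hp : d / 2 + 2 ≤ p) (hBS : B ⊆ S) (hB : B.card ≠ 0)
    {C₀ : ℝ} (h𝔥 : 0 < 𝔥) (h𝔥' : 0 < 𝔥') (hR : 0 < R) (hL : 1 ≤ L) (hRR : R' = L * R)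
    (hκ : 𝔥' ≤ κ * 𝔥) (h𝔥'le : 𝔥' ≤ 𝔥) (hC₁ : 0 ≤ C₁) (hρ : (ρ' : ℝ) ≤ C₁ * R) (hC₀ : 1 ≤ C₀)
    (hρ0 : (ρ' : ℝ) + (d / 2 + 1 : ℕ) ≤ C₀ * R) (hθ : 𝔥' / 𝔥 * (R / R') ≤ 1) (hr₀ : 3 ≤ r₀)
    (hK : ContDiff ℝ r₀ K) (hloc : IsGaugeLocal (fieldGauge 𝔥 R p S) K)
    {w : ((Fin d → ZMod M) → ℝ) → ℝ} (hw1 : ∀ ψ, 1 ≤ w ψ) (hw0 : w 0 = 1)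
    (hwray : ∀ ψ : (Fin d → ZMod M) → ℝ, ∀ t ∈ Set.Icc (0 : ℝ) 1, w (t • ψ) ≤ w ψ)
    {CF : ℝ} (hCF : 0 ≤ CF) (hKw : ∀ ψ, tayNorm (fieldGauge 𝔥 R p S) r₀ K ψ ≤ CF * w ψ)
    (hSS' : S ⊆ S') {w' : ((Fin d → ZMod M) → ℝ) → ℝ}
    (hw9 : ∀ φ, Real.exp (‖fieldGauge 𝔥' R' p S' φ‖ ^ 2 / 2) * w φ ≤ w' φ) :
    TayNormLE (fieldGauge 𝔥' R' p S') r₀ w' (Pi2Rem a B K)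
      (1536 * CF * blockContrConst d 𝔥 𝔥' R R' L κ C₁ C₀) := by
  intro φ
  have hR' : 0 < R' := by rw [hRR]; nlinarith
  have hp' : d / 2 + 1 ≤ p := by omega
  set cG := blockContrConst d 𝔥 𝔥' R R' L κ C₁ C₀ with hcG
  -- Lemma 10.3 on the smaller gauge set `S`
  have h1 := tayNorm_Pi2Rem_le_weighted_of_ray hS ha hroom hp hBS hB h𝔥 h𝔥' hR hL hRR hκ h𝔥'le hC₁
    hρ hC₀ hρ0 hθ hr₀ hK hloc hw1 hw0 hwray hCF hKw φ
  have hcG0 : 0 ≤ CF * cG := by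
    have h0 := tayNorm_Pi2Rem_le_weighted_of_ray hS ha hroom hp hBS hB h𝔥 h𝔥' hR hL hRR hκ h𝔥'le
      hC₁ hρ hC₀ hρ0 hθ hr₀ hK hloc hw1 hw0 hwray hCF hKw 0
    rw [map_zero, norm_zero, add_zero, one_pow, mul_one, hw0, mul_one] at h0
    exact (tayNorm_nonneg _ _ _ _).trans h0
  -- pass to the larger gauge set `S'`
  have hloc' : IsGaugeLocal (fieldGauge 𝔥' R' p S) (Pi2Rem a B K) :=
    isGaugeLocal_Pi2Rem h𝔥'.ne' hR'.ne' hp' hBS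
      ((isGaugeLocal_fieldGauge_iff h𝔥.ne' hR.ne' h𝔥'.ne' hR'.ne').1 hloc)
  have h2 : tayNorm (fieldGauge 𝔥' R' p S') r₀ (Pi2Rem a B K) φ ≤
      tayNorm (fieldGauge 𝔥' R' p S) r₀ (Pi2Rem a B K) φ :=
    tayNorm_fieldGauge_anti_set 𝔥' R' p hSS' (contDiff_Pi2Rem hK) hloc' φ
  have h3 : ‖fieldGauge 𝔥' R' p S φ‖ ≤ ‖fieldGauge 𝔥' R' p S' φ‖ :=
    norm_fieldGauge_mono_set 𝔥' R' p hSS' φ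
  set t := ‖fieldGauge 𝔥' R' p S' φ‖ with ht
  have ht0 : 0 ≤ t := norm_nonneg _
  have hw0' : 0 ≤ w φ := by linarith [hw1 φ]
  have h4 : (1 + ‖fieldGauge 𝔥' R' p S φ‖) ^ 5 ≤ (1 + t) ^ 5 := by
    have : 0 ≤ 1 + ‖fieldGauge 𝔥' R' p S φ‖ := by positivity
    gcongr
  have h5 := one_add_pow_five_le ht0
  calc tayNorm (fieldGauge 𝔥' R' p S') r₀ (Pi2Rem a B K) φ
      ≤ CF * cG * (1 + ‖fieldGauge 𝔥' R' p S φ‖) ^ 5 * w φ := h2.trans h1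
    _ ≤ CF * cG * (1536 * Real.exp (t ^ 2 / 2)) * w φ := by gcongr; exact h4.trans h5
    _ = 1536 * CF * cG * (Real.exp (t ^ 2 / 2) * w φ) := by ring
    _ ≤ 1536 * CF * cG * w' φ :=
        mul_le_mul_of_nonneg_left (hw9 φ) (by nlinarith [hcG0])

end SingleBlock

end Literature.MathematicalPhysics.StatisticalMechanics.GradientRG

end
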